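import Mathlib
import Summits.Ventures.HodgeRepro.Tier4.Target
import Summits.Ventures.HodgeRepro.Tier4.Common.TargetData
import Summits.Ventures.HodgeRepro.Tier4.Common.TargetBall
import Summits.Ventures.HodgeRepro.Tier4.Common.TargetCalculus
import Summits.Ventures.HodgeRepro.Tier4.Common.TargetJacobian
import Summits.Ventures.HodgeRepro.Tier4.Common.AutForms
import Summits.Ventures.HodgeRepro.Tier4.LitCompactness
import Summits.Ventures.HodgeRepro.Tier4.Line4.MixedTransfer
import Summits.Ventures.HodgeRepro.Tier4.Line4.Forms11
import Summits.Ventures.HodgeRepro.Tier4.Line4.MixedInvariant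
import Summits.Ventures.HodgeRepro.Tier4.Line4.PullbackWedge
import Summits.Ventures.HodgeRepro.Tier4.Line4.HoloRegularity
import Summits.Ventures.HodgeRepro.Tier4.Line4.MixedClosed
import Summits.Ventures.HodgeRepro.Tier4.Line4.ExactOnBall
import Summits.Ventures.HodgeRepro.Tier4.Line4.WirtingerChain
import Summits.Ventures.HodgeRepro.Tier4.Line3.BallChangeOfVariables
import Summits.Ventures.HodgeRepro.Tier4.Line3.DomainTransfer
import Summits.Ventures.HodgeRepro.Tier4.Line4.DomainUnfold
import Summits.Ventures.HodgeRepro.Tier4.Line4.Partition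
import Summits.Ventures.HodgeRepro.Tier4.Line4.QuotientTiling
import Summits.Ventures.HodgeRepro.Tier4.Line4.StokesQuotient

/-!
# Tier4/Line4/Cohomology11 — the vocabulary of the `(1,1)`-side of LINE L4 (VERBATIM from the skeleton §2″), the
datum conversions to the level of the maps `ballActions`, and the span inductions for `pair11`

Blind re-derivation cell `pub-hodge-repro`, Tier 4 (README §9–§10), seat t4-L4-p2 (prover, LINE L4, gen 0).  Tree path
`lean/Summits/Ventures/HodgeRepro/Tier4/Line4/Cohomology11.lean`.  The definitions `Forms1`, `pull1`, `IsInvariant1`,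
`Smooth1`, `d11`, `IsPure11`, `onBall`, `Z11`, `B11` are copied VERBATIM from the skeleton v0.10 L158–L192 (t4-plan-4)
so that L4.0′ `pair11_descends` can be stated through the gate (`PairDescends.lean`).  Also: the hypotheses of
`LitCompactness` (cocompactness, proper discontinuity) and the invariance predicates of the datum read on the set of
MAPS `ballActions d.τ₀ d.C Γ′`; and the bilinearity of `pair11` with the two span inductions
(`pair11_eq_zero_of_span`, `integrableOn_wedge_of_span`, via `Submodule.span_induction₂`).

Nothing here says anything about the status of the Hodge conjecture for CM abelian varieties, which is NOT proved
(HC_CM is NOT proved by anyone in this repository).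
-/

set_option autoImplicit false

noncomputable section

open Matrix MeasureTheory NumberField Topology Set
open scoped ComplexConjugate ComplexOrder

namespace Summit.Ventures.HodgeRepro.Tier4.Line4

open Summit.Ventures.HodgeRepro.Tier4 Summit.Ventures.HodgeRepro.Tier4.Line3

variable {F E : Type} [Field F] [NumberField F] [IsGalois ℚ F] [IsCMField F]
  [Field E] [NumberField E] [IsGalois ℚ E] [IsCMField E] (d : TargetData F E)

/-! ## 1. The vocabulary of the `(1,1)`-side (VERBATIM from the skeleton §2″) -/

/-- A `1`-form `η = Σ_k η¹_k dz_k + Σ_l η²_l dz̄_l` as the pair of its coefficient vectors. -/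
abbrev Forms1 := (Fin 2 → ℂ) → (Fin 2 → ℂ) × (Fin 2 → ℂ)

/-- The pullback of a `1`-form under a holomorphic map `g`: `(g^*η)¹(z) = J(z)ᵀ η¹(g z)`, `(g^*η)²(z) = conj J(z)ᵀ η²(g z)`. -/
def pull1 (g : (Fin 2 → ℂ) → (Fin 2 → ℂ)) (η : Forms1) : Forms1 :=
  fun z => ((jacMat g z)ᵀ *ᵥ (η (g z)).1, ((jacMat g z).map (starRingEnd ℂ))ᵀ *ᵥ (η (g z)).2)

/-- `Γ′`-invariance of a `1`-form on the ball. -/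
def IsInvariant1 (Γ' : Set (Matrix (Fin 3) (Fin 3) E)) (η : Forms1) : Prop :=
  ∀ γ ∈ Γ', ∀ z ∈ ball, pull1 (d.act γ) η z = η z

/-- `C²`-smoothness of a `1`-form on the ball. -/
def Smooth1 (η : Forms1) : Prop :=
  ∀ k : Fin 2, ContDiffOn ℝ 2 (fun z => (η z).1 k) ball ∧ ContDiffOn ℝ 2 (fun z => (η z).2 k) ball

/-- The `(1,1)`-part of `dη`: `(dη)^{1,1}_{kl} = ∂_k η²_l − ∂̄_l η¹_k`. -/
def d11 (η : Forms1) : Forms11 :=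
  fun z => Matrix.of fun k l => dz k (fun w => (η w).2 l) z - dzbar l (fun w => (η w).1 k) z

/-- `dη` has no `(2,0)`-part (`∂_k η¹_l` symmetric) and no `(0,2)`-part (`∂̄_k η²_l` symmetric) on the ball. -/
def IsPure11 (η : Forms1) : Prop :=
  ∀ z ∈ ball, (∀ k l : Fin 2, dz k (fun w => (η w).1 l) z = dz l (fun w => (η w).1 k) z) ∧
    (∀ k l : Fin 2, dzbar k (fun w => (η w).2 l) z = dzbar l (fun w => (η w).2 k) z)

/-- Restriction to the ball: a form is determined by its values on the ball (`0` outside). -/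
def onBall (ξ : Forms11) : Forms11 := fun z => open Classical in if z ∈ ball then ξ z else 0

/-- The cocycles: the `ℂ`-span of the smooth closed `Γ′`-invariant `(1,1)`-forms on the ball (restricted to the ball). -/
def Z11 (Γ' : Set (Matrix (Fin 3) (Fin 3) E)) : Submodule ℂ Forms11 :=
  Submodule.span ℂ {ζ | ∃ ξ : Forms11, Smooth11 ξ ∧ IsClosed11 ξ ∧ IsInvariant11 d Γ' ξ ∧ ζ = onBall ξ}

/-- The coboundaries: the `ℂ`-span of the `(1,1)`-forms `dη` (restricted to the ball) for smooth `Γ′`-invariant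
`1`-forms `η` with `dη` of pure type `(1,1)`. -/
def B11 (Γ' : Set (Matrix (Fin 3) (Fin 3) E)) : Submodule ℂ Forms11 :=
  Submodule.span ℂ {ζ | ∃ η : Forms1, Smooth1 η ∧ IsInvariant1 d Γ' η ∧ IsPure11 η ∧ ζ = onBall (d11 η)}

/-! ## 4. The datum: conversions of the hypotheses to the level of the maps `ballActions` -/

section Datum

/-- `τ₀ ∘ c = conj ∘ τ₀` for the CM conjugation of `E`. -/
theorem hτ_of_datum : ∀ x, d.τ₀ (conjE E x) = conj (d.τ₀ x) := fun x => complexConj_intertwines E d.τ₀ x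

/-- `ballActions` of the datum is the set of `d.act γ`, `γ ∈ Γ′`. -/
theorem act_mem_ballActions {Γ' : Set (Matrix (Fin 3) (Fin 3) E)} {γ : Matrix (Fin 3) (Fin 3) E} (hγ : γ ∈ Γ') :
    d.act γ ∈ ballActions d.τ₀ d.C Γ' := ⟨γ, hγ, rfl⟩

/-- Cocompactness (K) of `LitCompactness`, read on the maps. -/
theorem cocompact_of_lit (hK : Lit.BorelHarishChandra1962_Thm11_8_cocompact_hdef E d.H d.τ₀ d.C)
    {Γ' : Set (Matrix (Fin 3) (Fin 3) E)} (hΓ' : d.IsLevel Γ') :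
    ∃ K : Set (Fin 2 → ℂ), IsCompact K ∧ K ⊆ ball ∧ ∀ z ∈ ball, ∃ φ ∈ ballActions d.τ₀ d.C Γ', φ z ∈ K := by
  obtain ⟨K, hKc, hKb, h⟩ := hK d.hH d.hani d.hC d.hdef Γ' hΓ'.1
  refine ⟨K, hKc, hKb, fun z hz => ?_⟩
  obtain ⟨γ, hγ, hγz⟩ := h z hz
  exact ⟨actM (toBallMat d.τ₀ d.C γ), ⟨γ, hγ, rfl⟩, hγz⟩

/-- Proper discontinuity (P) of `LitCompactness`, read on the maps. -/
theorem properlyDiscontinuous_of_lit (hP : Lit.BorelHarishChandra1962_properlyDiscontinuous_hdef E d.H d.τ₀ d.C)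
    {Γ' : Set (Matrix (Fin 3) (Fin 3) E)} (hΓ' : d.IsLevel Γ') :
    ∀ K : Set (Fin 2 → ℂ), IsCompact K → K ⊆ ball →
      {φ ∈ ballActions d.τ₀ d.C Γ' | ∃ z ∈ K, φ z ∈ K}.Finite := by
  intro K hKc hKb
  have hfin := hP d.hH d.hani d.hC d.hdef Γ' hΓ'.1 K hKc hKb
  refine (hfin.image fun γ => actM (toBallMat d.τ₀ d.C γ)).subset ?_
  rintro φ ⟨⟨γ, hγ, rfl⟩, z, hz, hφz⟩
  exact ⟨γ, ⟨hγ, z, hz, hφz⟩, rfl⟩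

/-- `IsInvariant11` of the datum, read on the maps. -/
theorem invariant11_of_datum {Γ' : Set (Matrix (Fin 3) (Fin 3) E)} {ξ : Forms11} (hξ : IsInvariant11 d Γ' ξ) :
    ∀ φ ∈ ballActions d.τ₀ d.C Γ', ∀ z ∈ ball, pull φ ξ z = ξ z := by
  rintro φ ⟨γ, hγ, rfl⟩ z hz
  exact hξ γ hγ z hz

/-- `IsInvariant1` of the datum, read on the maps and on the two coefficient vectors. -/
theorem invariant1_of_datum {Γ' : Set (Matrix (Fin 3) (Fin 3) E)} {η : Forms1} (hη : IsInvariant1 d Γ' η) :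
    ∀ φ ∈ ballActions d.τ₀ d.C Γ', ∀ z ∈ ball,
      (jacMat φ z)ᵀ *ᵥ (fun w => (η w).1) (φ z) = (fun w => (η w).1) z ∧
      ((jacMat φ z).map (starRingEnd ℂ))ᵀ *ᵥ (fun w => (η w).2) (φ z) = (fun w => (η w).2) z := by
  rintro φ ⟨γ, hγ, rfl⟩ z hz
  have h := hη γ hγ z hz
  exact ⟨congrArg Prod.fst h, congrArg Prod.snd h⟩

end Datum

/-! ## 5. Bilinearity of `pair11` and the span inductions -/

section Span

/-- `⟨(A + B) ∧ C⟩ = ⟨A ∧ C⟩ + ⟨B ∧ C⟩`. -/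
theorem wedgeCoeff11_add_left (A B C : Form11) : wedgeCoeff11 (A + B) C = wedgeCoeff11 A C + wedgeCoeff11 B C := by
  simp only [wedgeCoeff11, Matrix.add_apply]; ring

/-- `⟨A ∧ (B + C)⟩ = ⟨A ∧ B⟩ + ⟨A ∧ C⟩`. -/
theorem wedgeCoeff11_add_right (A B C : Form11) : wedgeCoeff11 A (B + C) = wedgeCoeff11 A B + wedgeCoeff11 A C := by
  simp only [wedgeCoeff11, Matrix.add_apply]; ring

/-- `⟨(r • A) ∧ C⟩ = r · ⟨A ∧ C⟩`. -/
theorem wedgeCoeff11_smul_left (r : ℂ) (A C : Form11) : wedgeCoeff11 (r • A) C = r * wedgeCoeff11 A C := by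
  simp only [wedgeCoeff11, Matrix.smul_apply, smul_eq_mul]; ring

/-- `⟨A ∧ (r • C)⟩ = r · ⟨A ∧ C⟩`. -/
theorem wedgeCoeff11_smul_right (r : ℂ) (A C : Form11) : wedgeCoeff11 A (r • C) = r * wedgeCoeff11 A C := by
  simp only [wedgeCoeff11, Matrix.smul_apply, smul_eq_mul]; ring

/-- `⟨0 ∧ C⟩ = 0`. -/
theorem wedgeCoeff11_zero_left (C : Form11) : wedgeCoeff11 0 C = 0 := by simp [wedgeCoeff11]

/-- `⟨A ∧ 0⟩ = 0`. -/
theorem wedgeCoeff11_zero_right (A : Form11) : wedgeCoeff11 A 0 = 0 := by simp [wedgeCoeff11]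

/-- **Span induction for the integrability and the vanishing of `pair11`**: if every pair of generators is integrable
on `D` with vanishing pairing, so is every pair of elements of the spans. -/
theorem pair11_eq_zero_of_span {S T : Set Forms11} (D : Set (Fin 2 → ℂ))
    (hST : ∀ a ∈ S, ∀ b ∈ T, IntegrableOn (fun z => wedgeCoeff11 (a z) (b z)) D ∧ pair11 D a b = 0)
    {a b : Forms11} (ha : a ∈ Submodule.span ℂ S) (hb : b ∈ Submodule.span ℂ T) :
    IntegrableOn (fun z => wedgeCoeff11 (a z) (b z)) D ∧ pair11 D a b = 0 := by
  refine Submodule.span_induction₂ (p := fun a b _ _ =>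
    IntegrableOn (fun z => wedgeCoeff11 (a z) (b z)) D ∧ pair11 D a b = 0) ?_ ?_ ?_ ?_ ?_ ?_ ?_ ha hb
  · intro x y hx hy; exact hST x hx y hy
  · intro y _
    refine ⟨?_, ?_⟩
    · simp only [Pi.zero_apply, wedgeCoeff11_zero_left]; exact integrableOn_zero
    · simp only [pair11, Pi.zero_apply, wedgeCoeff11_zero_left, integral_zero]
  · intro x _
    refine ⟨?_, ?_⟩
    · simp only [Pi.zero_apply, wedgeCoeff11_zero_right]; exact integrableOn_zero
    · simp only [pair11, Pi.zero_apply, wedgeCoeff11_zero_right, integral_zero]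
  · intro x y z _ _ _ ⟨hxi, hx0⟩ ⟨hyi, hy0⟩
    refine ⟨?_, ?_⟩
    · simp only [Pi.add_apply, wedgeCoeff11_add_left]; exact hxi.add hyi
    · simp only [pair11, Pi.add_apply, wedgeCoeff11_add_left] at hx0 hy0 ⊢
      rw [integral_add hxi hyi, hx0, hy0, add_zero]
  · intro x y z _ _ _ ⟨hxi, hx0⟩ ⟨hyi, hy0⟩
    refine ⟨?_, ?_⟩
    · simp only [Pi.add_apply, wedgeCoeff11_add_right]; exact hxi.add hyi
    · simp only [pair11, Pi.add_apply, wedgeCoeff11_add_right] at hx0 hy0 ⊢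
      rw [integral_add hxi hyi, hx0, hy0, add_zero]
  · intro r x y _ _ ⟨hxi, hx0⟩
    refine ⟨?_, ?_⟩
    · simp only [Pi.smul_apply, wedgeCoeff11_smul_left]; exact hxi.const_mul r
    · simp only [pair11, Pi.smul_apply, wedgeCoeff11_smul_left] at hx0 ⊢
      rw [integral_const_mul, hx0, mul_zero]
  · intro r x y _ _ ⟨hxi, hx0⟩
    refine ⟨?_, ?_⟩
    · simp only [Pi.smul_apply, wedgeCoeff11_smul_right]; exact hxi.const_mul r
    · simp only [pair11, Pi.smul_apply, wedgeCoeff11_smul_right] at hx0 ⊢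
      rw [integral_const_mul, hx0, mul_zero]

/-- **Span induction for the integrability of `pair11`'s integrand**. -/
theorem integrableOn_wedge_of_span {S T : Set Forms11} (D : Set (Fin 2 → ℂ))
    (hST : ∀ a ∈ S, ∀ b ∈ T, IntegrableOn (fun z => wedgeCoeff11 (a z) (b z)) D)
    {a b : Forms11} (ha : a ∈ Submodule.span ℂ S) (hb : b ∈ Submodule.span ℂ T) :
    IntegrableOn (fun z => wedgeCoeff11 (a z) (b z)) D := by
  refine Submodule.span_induction₂ (p := fun a b _ _ =>
    IntegrableOn (fun z => wedgeCoeff11 (a z) (b z)) D) ?_ ?_ ?_ ?_ ?_ ?_ ?_ ha hb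
  · intro x y hx hy; exact hST x hx y hy
  · intro y _; simp only [Pi.zero_apply, wedgeCoeff11_zero_left]; exact integrableOn_zero
  · intro x _; simp only [Pi.zero_apply, wedgeCoeff11_zero_right]; exact integrableOn_zero
  · intro x y z _ _ _ hxi hyi; simp only [Pi.add_apply, wedgeCoeff11_add_left]; exact hxi.add hyi
  · intro x y z _ _ _ hxi hyi; simp only [Pi.add_apply, wedgeCoeff11_add_right]; exact hxi.add hyi
  · intro r x y _ _ hxi; simp only [Pi.smul_apply, wedgeCoeff11_smul_left]; exact hxi.const_mul r
  · intro r x y _ _ hxi; simp only [Pi.smul_apply, wedgeCoeff11_smul_right]; exact hxi.const_mul r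

end Span

end Summit.Ventures.HodgeRepro.Tier4.Line4

end
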